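import Mathlib
import HarnessLib
import Summits.KontsevichZagierPeriods.KontsevichZagierPeriods.Theses.LinRedNormalForm
import Summits.KontsevichZagierPeriods.KontsevichZagierPeriods.Theorems.LinRedNormalFormDihedralNormalFormStubNestedReductionAux2

/-!
# `DihedralNormalForm`, line `torus-descent-sum-shadow`, stub `stub_nestedReduction` — Aux 3

Support file for the stub `stub_nestedReduction` (THEOREM N) of the crux `DihedralNormalForm`
(stmt-KontsevichZagierPeriods-3912, route `LinRedNormalForm`): **the multiplicity chain in
dimension `2`**.  Every representation `[□², c·x₀^{A₀}x₁^{A₁}(1−x₀)^{B₀}(1−x₁)^{B₁}/(1−x₀x₁)ⁿ]`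
with `n ≤ B₀ + B₁ + 1` (the convergent ones) is congruent modulo `KZ.relations` to an element of
the target `closure (WAtom 2 ∪ SD1Atom 2 ∪ AtomLT 2)` (`Nested.rep2_red`, registered as the
sub-goal `stub_nestedReductionAux3`), by strong induction on the multiplicity `n`:
* `n = 0`: a polynomial, one multi-term integrand-additivity move into SD1-directed monomials;
* `n = 1`: binomial expansion (1b), then each kernel term `x₀ᵖx₁^q/(1−x₀x₁)` is SD1-directed
  (`p ≠ q`) or a geometric series ending in the `ζ(2)` word atom (`p = q`);
* `n + 2`: the shift `x₀x₁ + (1 − x₀x₁) = 1` (1b) and ONE Newton–Leibniz move along `x₁` on the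
  open square (`Nested.nl_step`, via `Nested.nl_last_ocube`) with an atom-shaped primitive, whose
  byproducts have multiplicity `n + 1` and whose base is a polynomial atom of dimension `1`.
This is the dimension-`2` instance of phase (N2) of Theorem N.

References: M. Kontsevich, D. Zagier, *Periods* (2001), §1.2, rules (1)–(3).
-/

noncomputable section

open MeasureTheory Set

namespace Summit.KontsevichZagierPeriods.DihedralNormalForm.TorusDescent

open Literature.NumberTheory.Transcendental

namespace Nested

/-! ### `k = 2`, multiplicity `0` and `1`: pure rule 1b -/

/-- Binomial coefficients with signs, as rationals. -/
def bc (B i : ℕ) : ℚ := (B.choose i : ℚ) * (-1) ^ i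

/-- The double binomial expansion of `x₀^{A₀}x₁^{A₁}(1−x₀)^{B₀}(1−x₁)^{B₁}`. -/
theorem double_binomial (x : Fin 2 → ℝ) (A0 A1 B0 B1 : ℕ) :
    x 0 ^ A0 * x 1 ^ A1 * (1 - x 0) ^ B0 * (1 - x 1) ^ B1 =
      ∑ ij ∈ Finset.range (B0 + 1) ×ˢ Finset.range (B1 + 1),
        ((bc B0 ij.1 * bc B1 ij.2 : ℚ) : ℝ) * (x 0 ^ (A0 + ij.1) * x 1 ^ (A1 + ij.2)) := by
  have h0 := pow_mul_one_sub_pow (x 0) A0 B0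
  have h1 := pow_mul_one_sub_pow (x 1) A1 B1
  calc x 0 ^ A0 * x 1 ^ A1 * (1 - x 0) ^ B0 * (1 - x 1) ^ B1
      = (x 0 ^ A0 * (1 - x 0) ^ B0) * (x 1 ^ A1 * (1 - x 1) ^ B1) := by ring
    _ = ∑ i ∈ Finset.range (B0 + 1), ∑ j ∈ Finset.range (B1 + 1),
          ((B0.choose i : ℝ) * (-1) ^ i) * x 0 ^ (A0 + i) *
            (((B1.choose j : ℝ) * (-1) ^ j) * x 1 ^ (A1 + j)) := by
        rw [h0, h1, Finset.sum_mul_sum]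
    _ = _ := by
        rw [Finset.sum_product]
        refine Finset.sum_congr rfl fun i _ => Finset.sum_congr rfl fun j _ => ?_
        simp only [bc]
        push_cast
        ring

/-- **Multiplicity `0`** (polynomial atoms): one multi-term 1b move into directed monomials. -/
theorem rep2_red_zero (c : ℚ) (A0 A1 B0 B1 : ℕ) (h : 0 ≤ B0 + B1 + 1) :
    ∃ m ∈ Target 2, KZ.of (rep2 c A0 A1 B0 B1 0 h) - m ∈ KZ.relations := by
  let R : ℕ × ℕ → KZ.IntegralRep 2 := fun ij => monoRep 2 (c * (bc B0 ij.1 * bc B1 ij.2))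
    ![A0 + ij.1, A1 + ij.2]
  refine ⟨∑ ij ∈ Finset.range (B0 + 1) ×ˢ Finset.range (B1 + 1), KZ.of (R ij),
    sum_mem fun ij _ => of_monoRep_mem_target Nat.two_pos _ _, ?_⟩
  refine KZ.of_sub_sum_integrand_mem_relations _ R _ (fun _ _ => rfl) fun x _ => ?_
  simp only [rep2_integrand, g2, pow_zero, div_one, R, monoRep_integrand, Fin.prod_univ_two,
    Matrix.cons_val_zero, Matrix.cons_val_one]
  rw [double_binomial, Finset.mul_sum]
  refine Finset.sum_congr rfl fun ij _ => ?_
  push_cast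
  ring

/-- **Geometric series** (1b): `[c x₀ᴺx₁ᴺ/(1−x₀x₁)] = [c/(1−x₀x₁)] + Σ_{l<N} [−c x₀ˡx₁ˡ]`,
the bare kernel being the `ζ(2)` word atom and the monomials directed. -/
theorem rep2_red_diag (c : ℚ) (N : ℕ) :
    ∃ m ∈ Target 2, KZ.of (rep2 c N N 0 0 1 (by omega)) - m ∈ KZ.relations := by
  let R : ℕ → KZ.IntegralRep 2 := fun l =>
    if l < N then monoRep 2 (-c) (fun _ => l) else rep2 c 0 0 0 0 1 (by omega)
  have hRlt : ∀ l, l < N → R l = monoRep 2 (-c) (fun _ => l) := fun l hl => by simp [R, hl]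
  have hRN : R N = rep2 c 0 0 0 0 1 (by omega) := by simp [R]
  refine ⟨∑ l ∈ Finset.range (N + 1), KZ.of (R l), sum_mem fun l hl => ?_, ?_⟩
  · by_cases hlN : l < N
    · rw [hRlt l hlN]; exact of_monoRep_mem_target Nat.two_pos _ _
    · have : l = N := by
        have := Finset.mem_range.mp hl; omega
      rw [this, hRN]; exact of_rep2_word_mem_target c
  refine KZ.of_sub_sum_integrand_mem_relations _ R _ (fun l _ => ?_) fun x hx => ?_
  · by_cases hlN : l < N
    · rw [hRlt l hlN]; rfl
    · simp [R, hlN]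
  obtain ⟨h0, -, h1, -, hu, -⟩ := two_facts hx
  change (rep2 c N N 0 0 1 _).integrand x = ∑ l ∈ Finset.range (N + 1), (R l).integrand x
  rw [Finset.sum_range_succ, hRN, Finset.sum_congr rfl fun l hl => by
    rw [hRlt l (Finset.mem_range.mp hl)]]
  simp only [rep2_integrand, g2, monoRep_integrand, pow_zero, pow_one, mul_one,
    Fin.prod_univ_two]
  have hu1 : x 0 * x 1 ≠ 1 := by intro h; rw [h] at hu; simp at hu
  have hgeom := geom_sum_eq hu1 N
  have hsum : ∑ l ∈ Finset.range N, ((-c : ℚ) : ℝ) * (x 0 ^ l * x 1 ^ l) =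
      -(c : ℝ) * (((x 0 * x 1) ^ N - 1) / (x 0 * x 1 - 1)) := by
    rw [← hgeom, Finset.mul_sum]
    refine Finset.sum_congr rfl fun l _ => ?_
    push_cast
    rw [mul_pow]
  rw [hsum, mul_pow]
  have hu' : x 0 * x 1 - 1 ≠ 0 := sub_ne_zero.mpr hu1
  field_simp
  ring

/-- **Multiplicity `1`, single kernel term** `[c x₀ᵖ x₁^q/(1−x₀x₁)]`: directed if `p ≠ q`, the
geometric series if `p = q`. -/
theorem rep2_red_kernel (c : ℚ) (p q : ℕ) :
    ∃ m ∈ Target 2, KZ.of (rep2 c p q 0 0 1 (by omega)) - m ∈ KZ.relations := by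
  by_cases hpq : p = q
  · subst hpq; exact rep2_red_diag c p
  · exact ⟨_, of_rep2_kernel_mem_target_of_ne c hpq, by simp⟩

/-- **Multiplicity `1`**: binomial expansion (one multi-term 1b move, every term convergent because
dominated by the `ζ(2)` kernel) followed by `rep2_red_kernel` termwise. -/
theorem rep2_red_one (c : ℚ) (A0 A1 B0 B1 : ℕ) (h : 1 ≤ B0 + B1 + 1) :
    ∃ m ∈ Target 2, KZ.of (rep2 c A0 A1 B0 B1 1 h) - m ∈ KZ.relations := by
  let R : ℕ × ℕ → KZ.IntegralRep 2 := fun ij =>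
    rep2 (c * (bc B0 ij.1 * bc B1 ij.2)) (A0 + ij.1) (A1 + ij.2) 0 0 1 (by omega)
  have hrel : KZ.of (rep2 c A0 A1 B0 B1 1 h) -
      ∑ ij ∈ Finset.range (B0 + 1) ×ˢ Finset.range (B1 + 1), KZ.of (R ij) ∈ KZ.relations := by
    refine KZ.of_sub_sum_integrand_mem_relations _ R _ (fun _ _ => rfl) fun x _ => ?_
    simp only [rep2_integrand, g2, pow_zero, pow_one, mul_one, R]
    rw [double_binomial, Finset.sum_div, Finset.mul_sum]
    refine Finset.sum_congr rfl fun ij _ => ?_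
    push_cast
    ring
  -- reduce every term
  choose m hm hmrel using fun ij : ℕ × ℕ =>
    rep2_red_kernel (c * (bc B0 ij.1 * bc B1 ij.2)) (A0 + ij.1) (A1 + ij.2)
  refine ⟨∑ ij ∈ Finset.range (B0 + 1) ×ˢ Finset.range (B1 + 1), m ij,
    sum_mem fun ij _ => hm ij, ?_⟩
  have h2 := KZ.relations.sum_mem (t := Finset.range (B0 + 1) ×ˢ Finset.range (B1 + 1))
    (fun ij _ => hmrel ij)
  have := add_mem hrel h2
  rwa [Finset.sum_sub_distrib, sub_add_sub_cancel] at this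

/-! ### `k = 2`, multiplicity `≥ 2`: one rule-3 move along `x₁` lowers the multiplicity -/

/-- Coordinates of `Fin.snoc x t : Fin 2 → ℝ`. -/
theorem snoc2 (x : Fin 1 → ℝ) (t : ℝ) :
    (Fin.snoc x t : Fin 2 → ℝ) 0 = x 0 ∧ (Fin.snoc x t : Fin 2 → ℝ) 1 = t := by
  constructor
  · exact Fin.snoc_castSucc (α := fun _ : Fin 2 => ℝ) t x 0
  · exact Fin.snoc_last (α := fun _ : Fin 2 => ℝ) t x

/-- `g2` on a fibre of the last coordinate. -/
theorem g2_snoc (c : ℚ) (A0 A1 B0 B1 n : ℕ) (x : Fin 1 → ℝ) (t : ℝ) :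
    g2 c A0 A1 B0 B1 n (Fin.snoc x t) =
      (c : ℝ) * (x 0 ^ A0 * t ^ A1 * (1 - x 0) ^ B0 * (1 - t) ^ B1 / (1 - x 0 * t) ^ n) := by
  rw [g2, (snoc2 x t).1, (snoc2 x t).2]

/-- On the closed band `x₀x₁ ≠ 1`. -/
theorem cband_one_ne {z : Fin 2 → ℝ} (hz : z ∈ cband 1) : 1 - z 0 * z 1 ≠ 0 := by
  obtain ⟨hinit, h0, h1⟩ := mem_cband.mp hz
  have hz0 := hinit 0
  simp only [Fin.castSucc_zero, mem_Ioo] at hz0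
  have hlast : (Fin.last 1 : Fin 2) = 1 := rfl
  rw [hlast] at h0 h1
  nlinarith

/-- The sum of three representations on the open square (integrand additivity prerequisites). -/
def sum3Rep (r₁ r₂ r₃ : KZ.IntegralRep 2) (h₁ : r₁.domain = ocube 2) (h₂ : r₂.domain = ocube 2)
    (h₃ : r₃.domain = ocube 2) : KZ.IntegralRep 2 where
  domain := ocube 2
  integrand := fun x => r₁.integrand x + r₂.integrand x + r₃.integrand x
  isSemialgebraic_domain := isSemialgebraic_ocube 2
  isSemialgebraicFunOn_integrand :=
    IsSemialgebraicFunOn.add_holds (IsSemialgebraicFunOn.add_holds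
      (h₁ ▸ r₁.isSemialgebraicFunOn_integrand) (h₂ ▸ r₂.isSemialgebraicFunOn_integrand))
      (h₃ ▸ r₃.isSemialgebraicFunOn_integrand)
  integrableOn := ((h₁ ▸ r₁.integrableOn).add (h₂ ▸ r₂.integrableOn)).add (h₃ ▸ r₃.integrableOn)

/-- Splitting `sum3Rep` into its three pieces is a relation (iterated 1b). -/
theorem sum3Rep_sub_mem (r₁ r₂ r₃ : KZ.IntegralRep 2) (h₁ : r₁.domain = ocube 2)
    (h₂ : r₂.domain = ocube 2) (h₃ : r₃.domain = ocube 2) :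
    KZ.of (sum3Rep r₁ r₂ r₃ h₁ h₂ h₃) - KZ.of r₁ - KZ.of r₂ - KZ.of r₃ ∈ KZ.relations := by
  have h := KZ.of_sub_sum_integrand_mem_relations Finset.univ ![r₁, r₂, r₃]
    (sum3Rep r₁ r₂ r₃ h₁ h₂ h₃) (fun i _ => by fin_cases i <;> assumption) fun x _ => by
      simp [Fin.sum_univ_three, sum3Rep]
  simp only [Fin.sum_univ_three, Matrix.cons_val_zero, Matrix.cons_val_one,
    Matrix.cons_val] at h
  rwa [sub_sub, sub_sub, ← add_assoc]

/-- **The rule-3 step.**  For `n + 2 ≤ B₀ + B₁ + 1` let `G' = [c x₀^{A₀+1}x₁^{A₁+1}(1−x₀)^{B₀}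
(1−x₁)^{B₁}/(1−x₀x₁)^{n+2}]`, `T₁ = [c(A₁+1)/(n+1) · G(A₀,A₁,B₀,B₁,n+1)]`,
`T₂ = [−cB₁/(n+1) · G(A₀,A₁+1,B₀,B₁−1,n+1)]`; with the primitive
`F = c/(n+1) · x₀^{A₀}x₁^{A₁+1}(1−x₀)^{B₀}(1−x₁)^{B₁}/(1−x₀x₁)^{n+1}` one has `∂_{x₁}F = G' + T₁ + T₂`,
`F(x₀,0) = 0` and `F(x₀,1) = [B₁ = 0]·c/(n+1)·x₀^{A₀}(1−x₀)^{B₀−n−1}`, so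
`[G'] + [T₁] + [T₂] ≡ [□¹, F(·,1)]` modulo relations. -/
theorem nl_step (c : ℚ) (A0 A1 B0 B1 n : ℕ) (h : n + 2 ≤ B0 + B1 + 1) :
    KZ.of (rep2 c (A0 + 1) (A1 + 1) B0 B1 (n + 2) h) +
      KZ.of (rep2 (c * (A1 + 1) / (n + 1)) A0 A1 B0 B1 (n + 1) (by omega)) +
      KZ.of (rep2 (-(c * B1 / (n + 1))) A0 (A1 + 1) B0 (B1 - 1) (n + 1) (by omega)) -
      KZ.of (polyRep1 (if B1 = 0 then c / (n + 1) else 0) A0 (B0 - (n + 1))) ∈ KZ.relations := by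
  set G' := rep2 c (A0 + 1) (A1 + 1) B0 B1 (n + 2) h with hG'
  set T1 := rep2 (c * (A1 + 1) / (n + 1)) A0 A1 B0 B1 (n + 1) (by omega) with hT1
  set T2 := rep2 (-(c * B1 / (n + 1))) A0 (A1 + 1) B0 (B1 - 1) (n + 1) (by omega) with hT2
  set rb := polyRep1 (if B1 = 0 then c / (n + 1) else 0) A0 (B0 - (n + 1)) with hrb
  set R := sum3Rep G' T1 T2 rfl rfl rfl with hR
  -- the primitive
  set F : (Fin 2 → ℝ) → ℝ := g2 (c / (n + 1)) A0 (A1 + 1) B0 B1 (n + 1) with hF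
  have hn1 : ((n : ℝ) + 1) ≠ 0 := by positivity
  have hNL : KZ.of R - KZ.of rb ∈ KZ.relations := by
    refine nl_last_ocube R rb F R.integrand rfl (fun _ _ => rfl) rfl ?_ ?_ ?_ ?_ ?_
    · -- W semialgebraic on the closed band
      exact IsSemialgebraicFunOn.add_holds (IsSemialgebraicFunOn.add_holds
        (isSemialgebraicFunOn_g2 (isSemialgebraic_cband 1) (fun _ hz => cband_one_ne hz) _ _ _ _ _ _)
        (isSemialgebraicFunOn_g2 (isSemialgebraic_cband 1) (fun _ hz => cband_one_ne hz) _ _ _ _ _ _))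
        (isSemialgebraicFunOn_g2 (isSemialgebraic_cband 1) (fun _ hz => cband_one_ne hz) _ _ _ _ _ _)
    · exact isSemialgebraicFunOn_g2 (isSemialgebraic_cband 1) (fun _ hz => cband_one_ne hz) _ _ _ _ _ _
    · -- continuity on the closed fibre
      intro x hx
      have hx0 := hx 0
      simp only [mem_Ioo] at hx0
      have hfun : (fun t : ℝ => F (Fin.snoc x t)) = fun t : ℝ => ((c / (n + 1) : ℚ) : ℝ) *
          (x 0 ^ A0 * t ^ (A1 + 1) * (1 - x 0) ^ B0 * (1 - t) ^ B1) / (1 - x 0 * t) ^ (n + 1) := by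
        funext t; rw [hF, g2_snoc]; ring
      rw [hfun]
      refine ContinuousOn.div (by fun_prop) (by fun_prop) fun t ht => pow_ne_zero _ ?_
      have : x 0 * t ≤ x 0 * 1 := mul_le_mul_of_nonneg_left ht.2 hx0.1.le
      nlinarith
    · -- the derivative along the fibre
      intro x hx t ht
      have hx0 := hx 0
      simp only [mem_Ioo] at hx0 ht
      have hxt : 1 - x 0 * t ≠ 0 := by nlinarith
      set K : ℝ := ((c / (n + 1) : ℚ) : ℝ) * x 0 ^ A0 * (1 - x 0) ^ B0 with hK
      have hfun : (fun s : ℝ => F (Fin.snoc x s)) =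
          fun s : ℝ => K * (s ^ (A1 + 1) * (1 - s) ^ B1) / (1 - x 0 * s) ^ (n + 1) := by
        funext s; rw [hF, g2_snoc, hK]; ring
      rw [hfun]
      have h1 : HasDerivAt (fun s : ℝ => s ^ (A1 + 1)) (↑(A1 + 1) * t ^ (A1 + 1 - 1)) t :=
        hasDerivAt_pow (A1 + 1) t
      have h2 : HasDerivAt (fun s : ℝ => (1 - s) ^ B1) (↑B1 * (1 - t) ^ (B1 - 1) * (-1)) t :=
        ((hasDerivAt_id' t).const_sub 1).fun_pow B1
      have h3 : HasDerivAt (fun s : ℝ => 1 - x 0 * s) (-(x 0 * 1)) t :=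
        ((hasDerivAt_id' t).const_mul (x 0)).const_sub 1
      have hd := ((h1.fun_mul h2).const_mul K).fun_div (h3.fun_pow (n + 1)) (pow_ne_zero _ hxt)
      refine hd.congr_deriv ?_
      change _ = G'.integrand (Fin.snoc x t) + T1.integrand (Fin.snoc x t) + T2.integrand (Fin.snoc x t)
      rw [hG', hT1, hT2, rep2_integrand, rep2_integrand, rep2_integrand, g2_snoc, g2_snoc, g2_snoc, hK]
      simp only [Nat.add_sub_cancel, mul_one]
      push_cast
      rcases Nat.eq_zero_or_pos B1 with hB | hB
      · subst hB
        simp only [pow_zero, Nat.cast_zero, zero_mul, mul_zero, mul_one, add_zero, Nat.zero_sub,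
          neg_zero, zero_div]
        field_simp
        ring
      · obtain ⟨b, rfl⟩ : ∃ b, B1 = b + 1 := ⟨B1 - 1, by omega⟩
        simp only [Nat.add_sub_cancel]
        push_cast
        field_simp
        ring
    · -- the base
      intro x hx
      have hx0 := hx 0
      simp only [mem_Ioo] at hx0
      have h1x : (1 : ℝ) - x 0 ≠ 0 := by linarith
      rw [hrb, hF, g2_snoc, g2_snoc]
      change ((if B1 = 0 then c / (n + 1) else 0 : ℚ) : ℝ) * (x 0 ^ A0 * (1 - x 0) ^ (B0 - (n + 1))) = _
      rcases Nat.eq_zero_or_pos B1 with hB | hB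
      · subst hB
        have hB0 : n + 1 ≤ B0 := by omega
        simp only [if_true, pow_zero, mul_one, one_pow, sub_self, ne_eq, Nat.add_eq_zero_iff,
          one_ne_zero, and_false, not_false_eq_true, zero_pow, mul_zero, zero_mul, zero_div, sub_zero]
        rw [pow_sub₀ _ h1x hB0]
        ring
      · have hB' : B1 ≠ 0 := by omega
        simp [hB', zero_pow hB']
  have hsplit := sum3Rep_sub_mem G' T1 T2 rfl rfl rfl
  have := sub_mem hNL hsplit
  convert this using 1
  abel

/-- **Every `k = 2` atom with a denominator reduces** (strong induction on the multiplicity `n`):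
`n = 0` polynomial, `n = 1` binomial + kernel, `n + 2`: shift (1b) + the rule-3 step + induction for
the three byproducts of multiplicity `n + 1`. -/
theorem rep2_red : ∀ (n : ℕ) (c : ℚ) (A0 A1 B0 B1 : ℕ) (h : n ≤ B0 + B1 + 1),
    ∃ m ∈ Target 2, KZ.of (rep2 c A0 A1 B0 B1 n h) - m ∈ KZ.relations := by
  intro n
  induction n using Nat.strong_induction_on with
  | _ n IH =>
    intro c A0 A1 B0 B1 h
    rcases n with _ | _ | n
    · exact rep2_red_zero c A0 A1 B0 B1 h
    · exact rep2_red_one c A0 A1 B0 B1 h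
    · -- shift `x₀x₁ + (1 − x₀x₁) = 1`
      have hshift : KZ.of (rep2 c A0 A1 B0 B1 (n + 2) h) -
          KZ.of (rep2 c (A0 + 1) (A1 + 1) B0 B1 (n + 2) h) -
          KZ.of (rep2 c A0 A1 B0 B1 (n + 1) (by omega)) ∈ KZ.relations := by
        refine KZ.integrandAddRel_subset_relations ⟨2, rep2 c A0 A1 B0 B1 (n + 2) h,
          rep2 c (A0 + 1) (A1 + 1) B0 B1 (n + 2) h, rep2 c A0 A1 B0 B1 (n + 1) (by omega),
          rfl, rfl, fun x hx => ?_, rfl⟩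
        obtain ⟨-, -, -, -, hu, -⟩ := two_facts hx
        simp only [rep2_integrand, g2, Pi.add_apply]
        field_simp
        ring
      have hnl := nl_step c A0 A1 B0 B1 n h
      obtain ⟨m1, hm1, r1⟩ := IH (n + 1) (by omega) c A0 A1 B0 B1 (by omega)
      obtain ⟨m2, hm2, r2⟩ := IH (n + 1) (by omega) (c * (A1 + 1) / (n + 1)) A0 A1 B0 B1 (by omega)
      obtain ⟨m3, hm3, r3⟩ :=
        IH (n + 1) (by omega) (-(c * B1 / (n + 1))) A0 (A1 + 1) B0 (B1 - 1) (by omega)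
      refine ⟨m1 + (KZ.of (polyRep1 (if B1 = 0 then c / (n + 1) else 0) A0 (B0 - (n + 1))) - m2 - m3),
        add_mem hm1 (sub_mem (sub_mem (of_polyRep1_mem_target _ _ _) hm2) hm3), ?_⟩
      have := sub_mem (sub_mem (add_mem (add_mem hshift hnl) r1) r2) r3
      convert this using 1
      abel

/-! ### Two tools for the final assembly in dimension `2` -/

/-- The binomial expansion of a NUMERATOR kernel: `(1 − x₀x₁)^C = Σ_l C(C,l)(−1)^l (x₀x₁)^l`, read
as a multi-term 1b move into `rep2 _ _ _ B₀ B₁ 0`. -/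
theorem numerator_kernel_expand (q : ℚ) (a0 a1 B0 B1 C : ℕ) (x : Fin 2 → ℝ) :
    (q : ℝ) * (x 0 ^ a0 * x 1 ^ a1 * ((1 - x 0) ^ B0 * (1 - x 0 * x 1) ^ C * (1 - x 1) ^ B1)) =
      ∑ l ∈ Finset.range (C + 1), g2 (q * bc C l) (a0 + l) (a1 + l) B0 B1 0 x := by
  have h := pow_mul_one_sub_pow (x 0 * x 1) 0 C
  rw [pow_zero, one_mul] at h
  rw [h]
  simp only [Finset.mul_sum, Finset.sum_mul]
  refine Finset.sum_congr rfl fun l _ => ?_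
  simp only [g2, bc, pow_zero, div_one, zero_add, mul_pow, pow_add]
  push_cast
  ring

/-- No uniform mass on infinitely many disjoint pieces of an integrable nonnegative function. -/
theorem no_uniform_boxes {f : (Fin 2 → ℝ) → ℝ} (hf : IntegrableOn f (ocube 2))
    (hnn : ∀ x ∈ ocube 2, 0 ≤ f x) (Q : ℕ → Set (Fin 2 → ℝ)) (hQm : ∀ j, MeasurableSet (Q j))
    (hQsub : ∀ j, Q j ⊆ ocube 2) (hdisj : Pairwise (Function.onFun Disjoint Q)) {C : ℝ} (hC : 0 < C)
    (hlow : ∀ j, C ≤ ∫ x in Q j, f x) : False := by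
  set I := ∫ x in ocube 2, f x with hI
  have hsum : ∀ N : ℕ, (N : ℝ) * C ≤ I := by
    intro N
    have h1 : ∫ x in ⋃ j ∈ Finset.range N, Q j, f x = ∑ j ∈ Finset.range N, ∫ x in Q j, f x :=
      integral_biUnion_finset (Finset.range N) (fun j _ => hQm j)
        (fun i _ j _ hij => hdisj hij) (fun j _ => hf.mono_set (hQsub j))
    have h2 : ∫ x in ⋃ j ∈ Finset.range N, Q j, f x ≤ I :=
      setIntegral_mono_set hf (ae_restrict_of_forall_mem (measurableSet_ocube 2) hnn)
        ((show (⋃ j ∈ Finset.range N, Q j) ≤ ocube 2 from iUnion₂_subset fun j _ => hQsub j).eventuallyLE)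
    calc (N : ℝ) * C = ∑ _j ∈ Finset.range N, C := by simp
      _ ≤ ∑ j ∈ Finset.range N, ∫ x in Q j, f x := Finset.sum_le_sum fun j _ => hlow j
      _ ≤ I := h1 ▸ h2
  obtain ⟨N, hN⟩ := exists_nat_gt (I / C)
  have h := hsum N
  rw [div_lt_iff₀ hC] at hN
  linarith

end Nested

/-- **Registered sub-goal `stub_nestedReductionAux3`**: every representation
`[□², c·x₀^{A₀}x₁^{A₁}(1−x₀)^{B₀}(1−x₁)^{B₁}/(1−x₀x₁)ⁿ]` with `n ≤ B₀ + B₁ + 1` is congruent modulo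
`KZ.relations` to an element of `closure (WAtom 2 ∪ SD1Atom 2 ∪ AtomLT 2)` (`Nested.rep2_red`). -/
theorem stub_nestedReductionAux3 : ∀ (c : ℚ) (A0 A1 B0 B1 n : ℕ), n ≤ B0 + B1 + 1 → ∀ (s : Literature.NumberTheory.Transcendental.KZ.IntegralRep 2), s.domain = {x : Fin 2 → ℝ | ∀ i, x i ∈ Set.Ioo (0:ℝ) 1} → Set.EqOn s.integrand (fun x => (c : ℝ) * (x 0 ^ A0 * x 1 ^ A1 * (1 - x 0) ^ B0 * (1 - x 1) ^ B1 / (1 - x 0 * x 1) ^ n)) s.domain → ∃ m ∈ AddSubgroup.closure ({z : Literature.NumberTheory.Transcendental.KZ.FormalRep | ∃ (q : ℚ) (ε : Fin 2 → Bool) (s : Literature.NumberTheory.Transcendental.KZ.IntegralRep 2), s.domain = {x : Fin 2 → ℝ | ∀ i, x i ∈ Set.Ioo (0:ℝ) 1} ∧ Set.EqOn s.integrand (fun x => (q : ℝ) * ((∏ i : Fin 2, x i ^ (2 - 1 - (i : ℕ))) * ∏ i : Fin 2, if ε i then 1 / (1 - (∏ l : Fin 2, if l ≤ i then x l else 1))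 else 1 / (∏ l : Fin 2, if l ≤ i then x l else 1))) s.domain ∧ z = Literature.NumberTheory.Transcendental.KZ.of s} ∪ {z : Literature.NumberTheory.Transcendental.KZ.FormalRep | ∃ (q : ℚ) (a : Fin 2 → ℕ) (e : Fin 2 → Fin 2 → ℤ) (s : Literature.NumberTheory.Transcendental.KZ.IntegralRep 2), (∃ lam : Fin 2 → ℤ, (∀ l : Fin 2, lam l = 0 ∨ lam l = 1 ∨ lam l = -1) ∧ (∃ p : Fin 2, lam p = -1) ∧ (Finset.univ.filter (fun l : Fin 2 => lam l = 1)).card ≤ 1 ∧ (∀ i j : Fin 2, i ≤ j → e i j ≠ 0 → (∑ l : Fin 2, if i ≤ l ∧ l ≤ j then lam l else 0) = 0) ∧ (∑ l : Fin 2, lam l * ((a l : ℤ) + 1)) ≠ 0) ∧ s.domain = {x : Fin 2 → ℝ | ∀ i, x i ∈ Set.Ioo (0:ℝ) 1} ∧ Set.EqOn s.integrand (fun x => (q : ℝ) * ((∏ i : Fin 2, x i ^ a i) * ∏ i : Fin 2, ∏ j : Fin 2, if i ≤ j then (1 - (∏ l : Fin 2, if i ≤ l ∧ l ≤ j then x l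 else 1)) ^ e i j else 1)) s.domain ∧ z = Literature.NumberTheory.Transcendental.KZ.of s} ∪ {z : Literature.NumberTheory.Transcendental.KZ.FormalRep | ∃ d : ℕ, d < 2 ∧ z ∈ {z : Literature.NumberTheory.Transcendental.KZ.FormalRep | ∃ (q : ℚ) (a : Fin d → ℕ) (e : Fin d → Fin d → ℤ) (s : Literature.NumberTheory.Transcendental.KZ.IntegralRep d), s.domain = {x : Fin d → ℝ | ∀ i, x i ∈ Set.Ioo (0:ℝ) 1} ∧ Set.EqOn s.integrand (fun x => (q : ℝ) * ((∏ i : Fin d, x i ^ a i) * ∏ i : Fin d, ∏ j : Fin d, if i ≤ j then (1 - (∏ l : Fin d, if i ≤ l ∧ l ≤ j then x l else 1)) ^ e i j else 1)) s.domain ∧ z = Literature.NumberTheory.Transcendental.KZ.of s}}), Literature.NumberTheory.Transcendental.KZ.of s - m ∈ Literature.NumberTheory.Transcendental.KZ.relations := by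
  intro c A0 A1 B0 B1 n h s hdom hint
  obtain ⟨m, hm, hrel⟩ := Nested.rep2_red n c A0 A1 B0 B1 h
  have hcongr : KZ.of s - KZ.of (Nested.rep2 c A0 A1 B0 B1 n h) ∈ KZ.relations :=
    KZ.of_sub_of_mem_relations_of_eqOn (by rw [hdom]; rfl) fun x hx => by
      rw [hint hx]; rfl
  refine ⟨m, hm, ?_⟩
  have := add_mem hcongr hrel
  rwa [sub_add_sub_cancel] at this

end Summit.KontsevichZagierPeriods.DihedralNormalForm.TorusDescent
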